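import Mathlib
import Summits.HodgeConjecture.FermatCycles.HodgeFermatDescent
import Summits.HodgeConjecture.FermatCycles.HodgeFermatTheoremL13
import Summits.HodgeConjecture.FermatCycles.HodgeFermatTheoremZ3UB
import Summits.HodgeConjecture.FermatCycles.HodgeFermatSevenThree

/-!
# The row (U, Z1) of THEOREM L at `p = 11` for squarefree levels divisible by 3 (`HodgeFermat/RowUZ1Eleven.lean`; HF-G29f)

Tree copy (whole module) of the module `HodgeFermat/RowUZ1Eleven.lean` of the sibling cell's standalone package
`run/shared/lean/pub/pub-hodgefermat/lean/HodgeFermat/` (367 lines, sha256 `67651637dce88523…`), source lines 51–367 (all: the carry lemmas `K_eleven`/`K_five`, the pointwise lemmas at 11 and 5, the kernel certificate `f33Check`, `row_UZ1_eleven`, `row_UZ1_eleven_up`).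
Filed by cell `pub-hfermat`, seat prover-1 gen-3, on the COORDINATOR KEEPER RULING of 2026-08-25 (gem sweep H1: take the
off-gate kernel theorem `thmFstar` through the gate) — here THEOREM F* of `tables/DPRIME-THEOREM.md` §9 IN FULL, i.e.
PROPOSITION D′(3N) and the descent (`HodgeFermat/PropDPrimeNFinal.lean`, GATE HF-G34), the last off-gate form of THEOREM F*
(its first two forms, `DecodingFinal.thmFstar` = F* at the prime levels and `ThmFstarNFinal.thmFstar` = F*(3N), landed on
2026-08-25 as `HodgeFermatThmFstar.lean` / `HodgeFermatThmFstarN.lean`, seats prover-1 gen-0 / gen-2); this file is one link of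
the import closure of `PropDPrimeNFinal.propDprime` (the sibling's KR-free chain: THEOREM L, COROLLARY M, THEOREM D6,
THEOREM U⁺, THEOREM KR6, THEOREM Z3U) on top of those landed chains.  The source module is the sibling's hub-checked module of
record (pub-hodgefermat cell record `check/RowUZ1Eleven_standalone.lean` sha256 `bfb5227d8cec5758…` (GATE HF-G29 series)); its declarations are copied VERBATIM.
Deviations from the source module, exhaustively: the `import` lines (tree modules `Summits.HodgeConjecture.FermatCycles.
HodgeFermat*` instead of `HodgeFermat.*`); this module docstring; the source's `open HodgeFermat.KRFree.Descent (descent sameType_symm' z3_vs_any three_or_fifteen prime_ge_seven)` (l.57) becomes `open HodgeFermat.KRFree.Descent (descent three_or_fifteen)` (`z3_vs_any` now being `TheoremL.z3_vs_any` of `HodgeFermatPropL7aB.lean`, visible through the module's `open … TheoremL`) followed by the two re-binding lines of `HodgeFermatDescent.lean` (`open HodgeFermat.KRFree.Decoding renaming st_symm → sameType_symm'`, `open Literature.NumberTheory.GaloisRepresentations.Serre1972 renaming seven_le_of_prime → prime_ge_seven`), because those two restated lemmas were deleted there; DEDUP (pre-empting the gate's `dedup.landed`): the source's `lemma div_three_mul`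 (l.62–63) restates `HodgeFermat.KRFree.SevenThree.div_three_mul` of `HodgeFermatSevenThree.lean` VERBATIM and is DELETED, re-bound by the added line `open HodgeFermat.KRFree.SevenThree (div_three_mul)` (extra import); one-line docstrings added (gate lint) to `K_eleven`, `K_five`, `f33Check_true`, `coprime33`.
Every other line — in particular every declaration's statement and proof — is byte-identical to the source.
HONEST FRAMING: explicit algebraic cycles for specific Hodge classes on Fermat/Delsarte varieties; residual open instances
listed; no claim on general Hodge.  (This file is arithmetic of CM types / finite combinatorics / analytic number theory
of the sibling's KR-free programme; it claims nothing about cycles.)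

The source module's docstring (RowUZ1Eleven.lean l.8–49), verbatim:

## The row (U, Z1) of THEOREM L at `p = 11` for squarefree levels divisible by 3

`tables/DPRIME-THEOREM.md` §3, THEOREM L, row (U, Z1): LEMMA O gives `k₁′ ≥ (p − 5)/2`, which excludes the
pattern for `p ≥ 13` (`TheoremL13.row_UZ1_ge_thirteen`) and, when `3 ∤ n`, for `p = 11`
(`TheoremL13.row_UZ1_ge_eleven_not3`).  The remaining case `p = 11`, `3 ∣ n` is the one place of THEOREM L
where the DESCENT LEMMA is needed ("for `p = 11` the only survivor of `k₁′ ≥ 3` forces `H_T̄ = H_V` with `V`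
constant, which DESCENT + LEVEL 3p kill").  This file closes it in the kernel, for squarefree odd `n` and pairs
that are jointly primitive at the level `11n` (hypothesis (JP) of THEOREM D6):

* `row_UZ1_eleven` — no pair `T = (11y, x₂, x₃)` (pattern Z1 at 11, `n ∤ y`), `T′ = (x′, y′, z′)` (pattern U
  at 11) has the same CM type at level `11·n`, `n` squarefree, odd, `11 ∤ n`, (JP).

Proof (all in the kernel, no hypothesis):
1. `TheoremL13.row_UZ1_three_g`: `n = 3g`, `g = gcd(y, n)`; so `⟨t₀y⟩_n ∈ {g, 2g}` and the carry
   `K(t₀) = ⌊11⟨t₀y⟩_n / n⌋ ∈ {3, 7}` (`K_eleven`).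
2. POINTWISE form of the fibre identity (Z1/U) (`pointwise₁₁`): with `|R(t₁) − R(t₀)| ≤ n` for both triples,
   `K = 3 ⟹ R′(t₁) = R′(t₀) + n` and `K = 7 ⟹ R′(t₀) = R′(t₁) + n` (`R′ = rsum n T′`).  Hence no entry of `T′`
   vanishes mod `n` (`no_zero₁₁`, via `TheoremZ3U.rsum_const`), `R′ ∈ {n, 2n}` on units, and
   `t₀ ∈ H_{T̄′} ⟺ K(t₀) = 3 ⟺ ⟨t₀y⟩_n = g ⟺ t₀ ∈ H_V`, `V = (ȳ, ȳ, ȳ)`, `ȳ = ⟨y⟩_n ∈ {g, 2g}`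
   (`sameType_V₁₁`, `inH_const`).
3. DESCENT LEMMA (`Descent.descent`): `x′ ≡ y′ ≡ z′ ≡ ȳ (mod n)`; in particular `g ∣ x′, y′, z′` (and `g ∣ y`).
4. SIEVE: a prime `q ∣ n`, `q ≠ 3`, divides `g`, hence `x′, y′, z′, 11y`; by (JP) and the zero sum it divides
   neither `x₂` nor `x₃`, so `(T′, T)` is (Z3, Z1) at `q` at the level `q · (11n/q)` — impossible for `q ≥ 7`
   (`Descent.z3_vs_any` = THEOREM L rows (Z3, Z1), (Z3, U)); so `q = 5` and `n ∈ {3, 15}`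
   (`Descent.three_or_fifteen`).
5. `n = 3` (level 33): `T′` is a unit triple at 33 and `T = (11y, x₂, x₃)`, `3 ∤ y`: excluded by the finite
   certificate `f33Check` (`decide` in the kernel; 11 520 residue pairs): NO unit triple at level 33 has the CM
   type of a triple `(11u, v, ·)`, `3 ∤ u`, `33 ∤ v` (`f33_sound`).
6. `n = 15` (level 165): `T′ = 5·T₁` with `T₁` a unit triple at 33, `T = (5·11y₅, x₂, x₃)` with `5 ∤ x₂x₃`
   ((JP) at 5), `3 ∤ y₅`: the pair is (Z3, Z1) at `p = 5` over `n₅ = 33 = 3·gcd(11y₅, 33)`; the POINTWISE form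
   of LEMMA N (Z1) against the sharp Z3 count `N = 4·h` (`TheoremZ3U.fibreCount_Z3_eq`) gives
   `h(t₀) = 1 ⟺ K₅(t₀) = 1 ⟺ ⟨t₀·11y₅⟩₃₃ = 11` (`pointwise₅`), i.e. `H_{T₁} = H_{(11u,11u,11u)}` at level 33,
   `u = ⟨y₅⟩₃` — again excluded by `f33Check`.

Consequences recorded here: `row_UZ1_eleven_up` — the row (U, Z1) is impossible for EVERY prime `p ≥ 11` at
squarefree odd jointly-primitive levels (combining with `row_UZ1_ge_thirteen`).

Light module: imports `Descent` (DESCENT LEMMA; brings `TheoremLRows`, `CoincEnum`, `CoincFull`), `TheoremL13` (`row_UZ1_three_g`,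
`val_cases`, `row_UZ1_ge_thirteen`) and `TheoremZ3U` (the sharp Z3 count `fibreCount_Z3_eq`, `rsum_const`; its KR6-conditional
theorems are not used).  No `sorry`, no `native_decide`, no axiom; `decide +kernel` only for the certificate `f33Check`.
-/

namespace HodgeFermat.KRFree.RowUZ1Eleven

open HodgeFermat.KRFree.LemmaN HodgeFermat.KRFree.LemmaO HodgeFermat.KRFree.TheoremL
open HodgeFermat.KRFree.TheoremUEq (Perm3)
open HodgeFermat.KRFree.CoincEnum (unitList inHB sameTypeB mem_unitList mem_unitList_mod inHB_iff third third_mod)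
open HodgeFermat.KRFree.CoincFull (nzList mem_nzList_mod)
open HodgeFermat.KRFree.Descent (descent three_or_fifteen)
open HodgeFermat.KRFree.TheoremZ3U (fibreCount_Z3_eq rsum_const)
open HodgeFermat.KRFree.Decoding renaming st_symm → sameType_symm'
open Literature.NumberTheory.GaloisRepresentations.Serre1972 renaming seven_le_of_prime → prime_ge_seven
open HodgeFermat.KRFree.SevenThree (div_three_mul)


/-! ## 1. The carry `K(t₀) = ⌊p⟨t₀y⟩_n / n⌋` when `n = 3·gcd(y, n)` -/


/-- the carry `⌊11⟨ty⟩_n / n⌋` when `n = 3·gcd(y, n)`: three cases -/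
lemma K_eleven {n y t : ℕ} (hn : 0 < n) (hn3 : n = 3 * Nat.gcd y n) (ht : Nat.Coprime t n) :
    (t * y % n = Nat.gcd y n ∧ 11 * (t * y % n) / n = 3) ∨
    (t * y % n = 2 * Nat.gcd y n ∧ 11 * (t * y % n) / n = 7) := by
  obtain ⟨g, hg⟩ : ∃ g, Nat.gcd y n = g := ⟨_, rfl⟩
  have hg0 : 0 < g := hg ▸ Nat.gcd_pos_of_pos_right _ hn
  have hv := val_cases n y t hn hn3 ht
  rw [hg] at hv hn3 ⊢
  rcases hv with h | h
  · left; refine ⟨h, ?_⟩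
    rw [h, hn3, show 11 * g = 2 * g + 3 * (3 * g) by ring]
    exact div_three_mul hg0 (by omega)
  · right; refine ⟨h, ?_⟩
    rw [h, hn3, show 11 * (2 * g) = g + 7 * (3 * g) by ring]
    exact div_three_mul hg0 (by omega)

/-- the carry `⌊5⟨ty⟩_n / n⌋` when `n = 3·gcd(y, n)`: three cases -/
lemma K_five {n y t : ℕ} (hn : 0 < n) (hn3 : n = 3 * Nat.gcd y n) (ht : Nat.Coprime t n) :
    (t * y % n = Nat.gcd y n ∧ 5 * (t * y % n) / n = 1) ∨
    (t * y % n = 2 * Nat.gcd y n ∧ 5 * (t * y % n) / n = 3) := by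
  obtain ⟨g, hg⟩ : ∃ g, Nat.gcd y n = g := ⟨_, rfl⟩
  have hg0 : 0 < g := hg ▸ Nat.gcd_pos_of_pos_right _ hn
  have hv := val_cases n y t hn hn3 ht
  rw [hg] at hv hn3 ⊢
  rcases hv with h | h
  · left; refine ⟨h, ?_⟩
    rw [h, hn3, show 5 * g = 2 * g + 1 * (3 * g) by ring]
    exact div_three_mul hg0 (by omega)
  · right; refine ⟨h, ?_⟩
    rw [h, hn3, show 5 * (2 * g) = g + 3 * (3 * g) by ring]
    exact div_three_mul hg0 (by omega)

/-- `H_V` for the constant triple `V = (ȳ, ȳ, ȳ)`, `n = 3·gcd(y, n)`: `t₀ ∈ H_V ⟺ ⟨t₀y⟩_n = gcd(y, n)`. -/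
lemma inH_const {n y t₀ : ℕ} (hn : 0 < n) (hn3 : n = 3 * Nat.gcd y n) (ht₀ : Nat.Coprime t₀ n) :
    InH n (y % n, y % n, y % n) t₀ ↔ t₀ * y % n = Nat.gcd y n := by
  have hg0 : 0 < Nat.gcd y n := Nat.gcd_pos_of_pos_right _ hn
  show t₀ * (y % n) % n + t₀ * (y % n) % n < n ↔ _
  rw [Nat.mul_mod_mod]
  rcases val_cases n y t₀ hn hn3 ht₀ with hv | hv <;> rw [hv] <;> constructor <;> intro _ <;> omega

/-! ## 2. The pointwise fibre identity (Z1 / U) at `p = 11` -/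

/-- POINTWISE (Z1/U) at `p = 11`, `n = 3g`: `K(t₀) = 3 ⟹ R′(t₁) = R′(t₀) + n`, `K(t₀) = 7 ⟹ R′(t₀) = R′(t₁) + n`. -/
lemma pointwise₁₁ {n y x₂ x₃ x' y' z' t₀ : ℕ} (h11n : ¬ 11 ∣ n) (hn : 0 < n) (hn3 : n = 3 * Nat.gcd y n)
    (hs : 11 * n ∣ 11 * y + x₂ + x₃) (hx₂ : ¬ 11 ∣ x₂) (hx₃ : ¬ 11 ∣ x₃)
    (hs' : 11 * n ∣ x' + y' + z') (hx' : ¬ 11 ∣ x') (hy' : ¬ 11 ∣ y') (hz' : ¬ 11 ∣ z')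
    (hH : SameType (11 * n) (11 * y, x₂, x₃) (x', y', z')) (ht₀ : Nat.Coprime t₀ n) :
    ∃ t₁, Nat.Coprime t₁ n ∧
      ((t₀ * y % n = Nat.gcd y n ∧ rsum n (x', y', z') t₁ = rsum n (x', y', z') t₀ + n) ∨
       (t₀ * y % n = 2 * Nat.gcd y n ∧ rsum n (x', y', z') t₀ = rsum n (x', y', z') t₁ + n)) := by
  have hp : (11).Prime := by norm_num
  obtain ⟨t₁, ht₁⟩ := exists_t₁ 11 n t₀ hp h11n hn
  have ht₁u := coprime_t₁ ht₁ ht₀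
  have hE := fibre_identity_Z1U 11 n y x₂ x₃ x' y' z' t₀ t₁ hp h11n hn hs hx₂ hx₃ hs' hx' hy' hz' ht₀ ht₁ hH
  have hd := delta_le n (11 * y) x₂ x₃ t₀ t₁ hn (dvd_of_level hs) ht₀ ht₁u
  have hd' := delta_le n x' y' z' t₀ t₁ hn (dvd_of_level hs') ht₀ ht₁u
  refine ⟨t₁, ht₁u, ?_⟩
  rcases K_eleven hn hn3 ht₀ with ⟨hv, hK⟩ | ⟨hv, hK⟩ <;> rw [hK] at hE
  · left; exact ⟨hv, by omega⟩
  · right; exact ⟨hv, by omega⟩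

/-- No entry of the U triple vanishes mod `n`. -/
lemma no_zero₁₁ {n y x₂ x₃ x' y' z' : ℕ} (h11n : ¬ 11 ∣ n) (hn : 0 < n) (hn3 : n = 3 * Nat.gcd y n)
    (hs : 11 * n ∣ 11 * y + x₂ + x₃) (hx₂ : ¬ 11 ∣ x₂) (hx₃ : ¬ 11 ∣ x₃)
    (hs' : 11 * n ∣ x' + y' + z') (hx' : ¬ 11 ∣ x') (hy' : ¬ 11 ∣ y') (hz' : ¬ 11 ∣ z')
    (hH : SameType (11 * n) (11 * y, x₂, x₃) (x', y', z')) : ¬ n ∣ x' ∧ ¬ n ∣ y' ∧ ¬ n ∣ z' := by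
  have h1 : Nat.Coprime 1 n := Nat.coprime_one_left n
  obtain ⟨t₁, ht₁u, h⟩ := pointwise₁₁ h11n hn hn3 hs hx₂ hx₃ hs' hx' hy' hz' hH h1
  have key : rsum n (x', y', z') t₁ ≠ rsum n (x', y', z') 1 := by
    rcases h with ⟨-, e⟩ | ⟨-, e⟩ <;> omega
  have hsn : n ∣ x' + y' + z' := dvd_of_level hs'
  exact ⟨fun hx => key (rsum_const hn hsn (Or.inl hx) ht₁u h1),
    fun hy => key (rsum_const hn hsn (Or.inr (Or.inl hy)) ht₁u h1),
    fun hz => key (rsum_const hn hsn (Or.inr (Or.inr hz)) ht₁u h1)⟩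

/-- `H_{T̄′} = H_V` on the units of `ℤ/n`, `V = (ȳ, ȳ, ȳ)`. -/
lemma sameType_V₁₁ {n y x₂ x₃ x' y' z' : ℕ} (h11n : ¬ 11 ∣ n) (hn : 0 < n) (hn3 : n = 3 * Nat.gcd y n)
    (hs : 11 * n ∣ 11 * y + x₂ + x₃) (hx₂ : ¬ 11 ∣ x₂) (hx₃ : ¬ 11 ∣ x₃)
    (hs' : 11 * n ∣ x' + y' + z') (hx' : ¬ 11 ∣ x') (hy' : ¬ 11 ∣ y') (hz' : ¬ 11 ∣ z')
    (hH : SameType (11 * n) (11 * y, x₂, x₃) (x', y', z')) :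
    SameType n (x', y', z') (y % n, y % n, y % n) := by
  obtain ⟨-, -, hzn⟩ := no_zero₁₁ h11n hn hn3 hs hx₂ hx₃ hs' hx' hy' hz' hH
  have hg0 : 0 < Nat.gcd y n := Nat.gcd_pos_of_pos_right _ hn
  have hsn : n ∣ x' + y' + z' := dvd_of_level hs'
  intro t₀ ht₀
  obtain ⟨t₁, ht₁u, h⟩ := pointwise₁₁ h11n hn hn3 hs hx₂ hx₃ hs' hx' hy' hz' hH ht₀
  have hz0 : ¬ n ∣ t₀ * z' := fun h => hzn (ht₀.symm.dvd_of_dvd_mul_left h)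
  have hz1 : ¬ n ∣ t₁ * z' := fun h => hzn (ht₁u.symm.dvd_of_dvd_mul_left h)
  obtain ⟨hc0, hiff0⟩ := rsum_cases hn hsn hz0
  obtain ⟨hc1, -⟩ := rsum_cases hn hsn hz1
  rw [hiff0, inH_const hn hn3 ht₀]
  rcases h with ⟨hv, e⟩ | ⟨hv, e⟩
  · refine ⟨fun _ => hv, fun _ => ?_⟩
    rcases hc0 with h0 | h0 <;> rcases hc1 with h1 | h1 <;> omega
  · refine ⟨fun hR => ?_, fun hv' => ?_⟩
    · exfalso; rcases hc1 with h1 | h1 <;> omega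
    · exfalso; omega

/-! ## 3. The pointwise identity (Z1 / Z3) at `p = 5` -/

/-- POINTWISE (Z1/Z3) at `p = 5`, `n = 3·gcd(y, n)`: against the sharp Z3 count `N = 4·h(t₀)`, LEMMA N (Z1)
forces `h(t₀) = 1 ⟺ K(t₀) = 1 ⟺ ⟨t₀y⟩_n = gcd(y, n)`. -/
lemma pointwise₅ {n y x₂ x₃ a b c t₀ : ℕ} (h5n : ¬ 5 ∣ n) (hn : 0 < n) (hn3 : n = 3 * Nat.gcd y n)
    (hs : 5 * n ∣ 5 * y + x₂ + x₃) (hx₂ : ¬ 5 ∣ x₂) (hx₃ : ¬ 5 ∣ x₃)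
    (hH : SameType (5 * n) (5 * y, x₂, x₃) (5 * a, 5 * b, 5 * c)) (ht₀ : Nat.Coprime t₀ n) :
    InH n (a, b, c) t₀ ↔ t₀ * y % n = Nat.gcd y n := by
  have hp : (5).Prime := by norm_num
  obtain ⟨t₁, ht₁⟩ := exists_t₁ 5 n t₀ hp h5n hn
  have ht₁u := coprime_t₁ ht₁ ht₀
  have hN := lemmaN_Z1 5 n y x₂ x₃ t₀ t₁ hp h5n hn hs hx₂ hx₃ ht₀ ht₁
  rw [fibreCount_congr hH, fibreCount_Z3_eq 5 n a b c t₀ hp h5n ht₀] at hN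
  have hd := delta_le n (5 * y) x₂ x₃ t₀ t₁ hn (dvd_of_level hs) ht₀ ht₁u
  have hg0 : 0 < Nat.gcd y n := Nat.gcd_pos_of_pos_right _ hn
  rcases K_five hn hn3 ht₀ with ⟨hv, hK⟩ | ⟨hv, hK⟩ <;> rw [hK] at hN
  · refine ⟨fun _ => hv, fun _ => ?_⟩
    by_contra hh; rw [if_neg hh] at hN; omega
  · refine ⟨fun hh => ?_, fun hv' => ?_⟩
    · exfalso; rw [if_pos hh] at hN; omega
    · exfalso; omega

/-! ## 4. Level 33: the finite certificate -/

/-- CERTIFICATE F33⁺: for `u ∈ {11, 22}`, every `v ∈ [1, 32]` and every unit pair `(a, b)` of `ℤ/33` whose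
third entry `c = −a−b` is a unit, the triples `(u, v, ·)` and `(a, b, c)` have different CM types at level 33
(`11 520` comparisons of `H ∩ (ℤ/33)ˣ`). -/
def f33Check : Bool :=
  [11, 22].all fun u => (nzList 33).all fun v => (unitList 33).all fun a => (unitList 33).all fun b =>
    !(Nat.gcd (third 33 a b) 33 == 1) || !(sameTypeB 33 u v a b)

/-- the level-33 certificate evaluates to `true` (kernel) -/
theorem f33Check_true : f33Check = true := by decide +kernel

/-- a number prime to 3 and 11 is prime to 33 -/
lemma coprime33 {x : ℕ} (h3 : ¬ 3 ∣ x) (h11 : ¬ 11 ∣ x) : Nat.Coprime x 33 :=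
  Nat.Coprime.mul_right ((Nat.Prime.coprime_iff_not_dvd Nat.prime_three).mpr h3).symm
    ((Nat.Prime.coprime_iff_not_dvd (by norm_num : Nat.Prime 11)).mpr h11).symm

/-- Soundness of F33⁺: no unit triple at level 33 has the CM type of a triple `(11y, x₂, x₃)`, `3 ∤ y`, `33 ∤ x₂`. -/
lemma f33_sound {y x₂ x₃ x' y' z' : ℕ} (hy3 : ¬ 3 ∣ y) (hx₂ : ¬ 33 ∣ x₂) (hs' : 33 ∣ x' + y' + z')
    (hxu : Nat.Coprime x' 33) (hyu : Nat.Coprime y' 33) (hzu : Nat.Coprime z' 33)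
    (hH : SameType 33 (11 * y, x₂, x₃) (x', y', z')) : False := by
  have h33 : 0 < 33 := by norm_num
  have hu : 11 * y % 33 ∈ [11, 22] := by
    have : 11 * y % 33 = 11 ∨ 11 * y % 33 = 22 := by omega
    rcases this with h | h <;> rw [h] <;> decide
  have hv : x₂ % 33 ∈ nzList 33 := mem_nzList_mod h33 hx₂
  have ha : x' % 33 ∈ unitList 33 := mem_unitList_mod h33 hxu
  have hb : y' % 33 ∈ unitList 33 := mem_unitList_mod h33 hyu
  have hc : (Nat.gcd (third 33 (x' % 33) (y' % 33)) 33 == 1) = true := by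
    rw [third_mod h33 hs', ← Nat.gcd_rec]
    exact beq_iff_eq.mpr (Nat.Coprime.gcd_eq_one hzu.symm)
  have hT : sameTypeB 33 (11 * y % 33) (x₂ % 33) (x' % 33) (y' % 33) = true := by
    refine List.all_eq_true.mpr fun t ht => beq_iff_eq.mpr (Bool.eq_iff_iff.mpr ?_)
    rw [inHB_iff x₃, inHB_iff z']
    exact hH t (mem_unitList.mp ht).2
  have step := List.all_eq_true.mp (List.all_eq_true.mp
    (List.all_eq_true.mp (List.all_eq_true.mp f33Check_true _ hu) _ hv) _ ha) _ hb
  simp [hc, hT] at step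

/-! ## 5. The two ends `n = 3` and `n = 15` -/

/-- The end `n = 3` (level 33): `T′` is a unit triple at 33. -/
lemma end₃₃ {y x₂ x₃ x' y' z' w : ℕ} (hw : w = 1 ∨ w = 2) (hy : ¬ 3 ∣ y) (hx₂ : ¬ 11 ∣ x₂)
    (hs' : 11 * 3 ∣ x' + y' + z') (hx' : ¬ 11 ∣ x') (hy' : ¬ 11 ∣ y') (hz' : ¬ 11 ∣ z')
    (ex : x' % 3 = 3 / 3 * w) (ey : y' % 3 = 3 / 3 * w) (ez : z' % 3 = 3 / 3 * w)
    (hH : SameType (11 * 3) (11 * y, x₂, x₃) (x', y', z')) : False := by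
  norm_num at ex ey ez
  have h3x : ¬ 3 ∣ x' := by rcases hw with rfl | rfl <;> omega
  have h3y : ¬ 3 ∣ y' := by rcases hw with rfl | rfl <;> omega
  have h3z : ¬ 3 ∣ z' := by rcases hw with rfl | rfl <;> omega
  exact f33_sound hy (fun h => hx₂ (Nat.dvd_trans ⟨3, rfl⟩ h)) hs' (coprime33 h3x hx') (coprime33 h3y hy')
    (coprime33 h3z hz') hH

/-- The end `n = 15` (level 165): `T′ = 5·T₁`, `T₁` a unit triple at 33, `T = (5·11y₅, x₂, x₃)`; the pair is
(Z3, Z1) at `p = 5` over `n₅ = 33 = 3·gcd(11y₅, 33)`, and `pointwise₅` gives `H_{T₁} = H_{(11u,11u,11u)}`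
at level 33, excluded by F33⁺. -/
lemma end₁₆₅ {y x₂ x₃ x' y' z' w : ℕ} (hw : w = 1 ∨ w = 2)
    (hs : 11 * 15 ∣ 11 * y + x₂ + x₃) (hx₂ : ¬ 5 ∣ x₂) (hx₃ : ¬ 5 ∣ x₃)
    (hs' : 11 * 15 ∣ x' + y' + z') (hx' : ¬ 11 ∣ x') (hy' : ¬ 11 ∣ y') (hz' : ¬ 11 ∣ z')
    (hyw : y % 15 = 15 / 3 * w) (ex : x' % 15 = 15 / 3 * w) (ey : y' % 15 = 15 / 3 * w)
    (ez : z' % 15 = 15 / 3 * w) (hH : SameType (11 * 15) (11 * y, x₂, x₃) (x', y', z')) : False := by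
  norm_num at hyw ex ey ez
  obtain ⟨y₅, rfl⟩ : 5 ∣ y := by omega
  obtain ⟨b₁, rfl⟩ : 5 ∣ x' := by omega
  obtain ⟨b₂, rfl⟩ : 5 ∣ y' := by omega
  obtain ⟨b₃, rfl⟩ : 5 ∣ z' := by omega
  have hy3 : ¬ 3 ∣ y₅ := by rcases hw with rfl | rfl <;> omega
  have h3b₁ : ¬ 3 ∣ b₁ := by rcases hw with rfl | rfl <;> omega
  have h3b₂ : ¬ 3 ∣ b₂ := by rcases hw with rfl | rfl <;> omega
  have h3b₃ : ¬ 3 ∣ b₃ := by rcases hw with rfl | rfl <;> omega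
  have h11b₁ : ¬ 11 ∣ b₁ := fun h => hx' (dvd_mul_of_dvd_right h 5)
  have h11b₂ : ¬ 11 ∣ b₂ := fun h => hy' (dvd_mul_of_dvd_right h 5)
  have h11b₃ : ¬ 11 ∣ b₃ := fun h => hz' (dvd_mul_of_dvd_right h 5)
  -- the pair at p = 5 over n₅ = 33
  have hH5 : SameType (5 * 33) (5 * (11 * y₅), x₂, x₃) (5 * b₁, 5 * b₂, 5 * b₃) := by
    rw [show 11 * (5 * y₅) = 5 * (11 * y₅) by ring] at hH; exact hH
  have hs5 : 5 * 33 ∣ 5 * (11 * y₅) + x₂ + x₃ := by omega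
  have hg : Nat.gcd (11 * y₅) 33 = 11 := by
    rw [show (33 : ℕ) = 11 * 3 by norm_num, Nat.gcd_mul_left,
      Nat.Coprime.gcd_eq_one ((Nat.Prime.coprime_iff_not_dvd Nat.prime_three).mpr hy3).symm]
  have hn3 : (33 : ℕ) = 3 * Nat.gcd (11 * y₅) 33 := by rw [hg]
  have h33 : (0 : ℕ) < 33 := by norm_num
  -- H_{T₁} = H_{(ȳ, ȳ, ȳ)} at level 33, ȳ = ⟨11 y₅⟩₃₃
  have hV : SameType 33 (11 * y₅ % 33, 11 * y₅ % 33, 11 * y₅ % 33) (b₁, b₂, b₃) := by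
    refine sameType_symm' fun t₀ ht₀ => ?_
    rw [pointwise₅ (by norm_num) h33 hn3 hs5 hx₂ hx₃ hH5 ht₀, inH_const h33 hn3 ht₀]
  rw [show 11 * y₅ % 33 = 11 * (y₅ % 3) by omega] at hV
  have hs33 : 33 ∣ b₁ + b₂ + b₃ := by omega
  exact f33_sound (y := y₅ % 3) (by omega) (by omega) hs33 (coprime33 h3b₁ h11b₁) (coprime33 h3b₂ h11b₂)
    (coprime33 h3b₃ h11b₃) hV

/-! ## 6. The theorem -/

/-- **THEOREM L, row (U, Z1), `p = 11`, `3 ∣ n` allowed** (`tables/DPRIME-THEOREM.md` §3): at a level `11·n`,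
`n` squarefree and odd, `11 ∤ n`, no pair `T = (11y, x₂, x₃)` (Z1 at 11: `11 ∤ x₂x₃`, `n ∤ y`),
`T′ = (x′, y′, z′)` (U at 11) that is jointly primitive at every prime of the level has the same CM type. -/
theorem row_UZ1_eleven (n y x₂ x₃ x' y' z' : ℕ) (hsq : Squarefree n) (h11n : ¬ 11 ∣ n) (hodd : Odd n)
    (hs : 11 * n ∣ 11 * y + x₂ + x₃) (hx₂ : ¬ 11 ∣ x₂) (hx₃ : ¬ 11 ∣ x₃)
    (hs' : 11 * n ∣ x' + y' + z') (hx' : ¬ 11 ∣ x') (hy' : ¬ 11 ∣ y') (hz' : ¬ 11 ∣ z') (hy : ¬ n ∣ y)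
    (hjp : ∀ q, Nat.Prime q → q ∣ 11 * n → q ∣ 11 * y → q ∣ x₂ → q ∣ x₃ → q ∣ x' → q ∣ y' → q ∣ z' → False)
    (hH : SameType (11 * n) (11 * y, x₂, x₃) (x', y', z')) : False := by
  have hp : (11).Prime := by norm_num
  have hn : 0 < n := hodd.pos
  have h2 : ¬ 2 ∣ n := fun h => (Nat.not_even_iff_odd.mpr hodd) (even_iff_two_dvd.mpr h)
  have hn3 := row_UZ1_three_g 11 n y x₂ x₃ x' y' z' hp le_rfl h11n hn hodd hs hx₂ hx₃ hs' hx' hy' hz' hy hH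
  obtain ⟨g, hg⟩ : ∃ g, Nat.gcd y n = g := ⟨_, rfl⟩
  have hgy : g ∣ y := hg ▸ Nat.gcd_dvd_left y n
  have hng : n = 3 * g := by rw [hn3, hg]
  have h3 : 3 ∣ n := ⟨g, hng⟩
  have hn3g : n / 3 = g := by rw [hng, Nat.mul_div_cancel_left g (by norm_num)]
  -- step 2: H_{T̄′} = H_V, no zero entry
  have hV := sameType_V₁₁ h11n hn hn3 hs hx₂ hx₃ hs' hx' hy' hz' hH
  obtain ⟨hxn, hyn, hzn⟩ := no_zero₁₁ h11n hn hn3 hs hx₂ hx₃ hs' hx' hy' hz' hH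
  obtain ⟨w, hw, hyw⟩ : ∃ w, (w = 1 ∨ w = 2) ∧ y % n = n / 3 * w := by
    rcases val_cases n y 1 hn hn3 (Nat.coprime_one_left n) with h | h <;> rw [one_mul, hg] at h
    · exact ⟨1, Or.inl rfl, by rw [h, hn3g, mul_one]⟩
    · exact ⟨2, Or.inr rfl, by rw [h, hn3g, mul_comm]⟩
  rw [hyw] at hV
  -- step 3: DESCENT
  obtain ⟨ex, ey, ez⟩ := descent n w x' y' z' hsq h2 h3 hw (dvd_of_level hs') hxn hyn hzn hV
  have hgn : g ∣ n := ⟨3, by rw [hng, mul_comm]⟩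
  have hgx : g ∣ x' := (Nat.dvd_mod_iff hgn).mp (by rw [ex, hn3g]; exact dvd_mul_right g w)
  have hgy' : g ∣ y' := (Nat.dvd_mod_iff hgn).mp (by rw [ey, hn3g]; exact dvd_mul_right g w)
  have hgz : g ∣ z' := (Nat.dvd_mod_iff hgn).mp (by rw [ez, hn3g]; exact dvd_mul_right g w)
  -- step 4: SIEVE — every prime of n other than 3 is 5
  have h35 : ∀ q, Nat.Prime q → q ∣ n → q = 3 ∨ q = 5 := by
    intro q hq hqn
    by_contra hc
    have hq3 : q ≠ 3 := fun e => hc (Or.inl e)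
    have hq5 : q ≠ 5 := fun e => hc (Or.inr e)
    have hq2 : q ≠ 2 := by rintro rfl; exact h2 hqn
    have h7 := prime_ge_seven hq hq2 hq3 hq5
    have hq11 : q ≠ 11 := by rintro rfl; exact h11n hqn
    have hqg : q ∣ g :=
      ((Nat.coprime_primes hq Nat.prime_three).mpr hq3).dvd_of_dvd_mul_left (by rw [← hng]; exact hqn)
    have hq11n : q ∣ 11 * n := dvd_mul_of_dvd_right hqn 11
    obtain ⟨N', hN'⟩ := hq11n
    have hN0 : 0 < N' := Nat.pos_of_ne_zero (by rintro rfl; simp at hN'; omega)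
    have hoddN : Odd N' :=
      (Nat.odd_mul.mp (show Odd (q * N') by rw [← hN']; exact Nat.odd_mul.mpr ⟨by decide, hodd⟩)).2
    have hqN : ¬ q ∣ N' := by
      rintro ⟨M, rfl⟩
      have hqq : q * q ∣ 11 * n := ⟨M, by rw [hN']; ring⟩
      have hqqn : q * q ∣ n :=
        (Nat.Coprime.mul_left ((Nat.coprime_primes hq hp).mpr hq11) ((Nat.coprime_primes hq hp).mpr hq11)).dvd_of_dvd_mul_left hqq
      exact hq.ne_one (Nat.isUnit_iff.mp (hsq q hqqn))
    obtain ⟨a, ha⟩ := hqg.trans hgx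
    obtain ⟨b, hb⟩ := hqg.trans hgy'
    obtain ⟨c, hc'⟩ := hqg.trans hgz
    have hqy : q ∣ 11 * y := dvd_mul_of_dvd_right (hqg.trans hgy) 11
    have hne : ¬ (q ∣ 11 * y ∧ q ∣ x₂ ∧ q ∣ x₃) := fun ⟨_, h₂, h₃⟩ =>
      hjp q hq (dvd_mul_of_dvd_right hqn 11) hqy h₂ h₃ (hqg.trans hgx) (hqg.trans hgy') (hqg.trans hgz)
    have hH' : SameType (q * N') (q * a, q * b, q * c) (11 * y, x₂, x₃) := by
      rw [← hN', ← ha, ← hb, ← hc']; exact sameType_symm' hH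
    refine z3_vs_any q N' a b c (11 * y) x₂ x₃ hq h7 hqN hN0 hoddN (by rw [← hN']; exact hs) hne
      ?_ ?_ ?_ hH'
    · rw [← hN']; exact fun h => hy (Nat.dvd_of_mul_dvd_mul_left (by norm_num) h)
    · rw [← hN']; exact fun h => hx₂ (Nat.dvd_trans (dvd_mul_right 11 n) h)
    · rw [← hN']; exact fun h => hx₃ (Nat.dvd_trans (dvd_mul_right 11 n) h)
  -- step 5/6: n ∈ {3, 15}
  rcases three_or_fifteen hsq h3 h35 with rfl | rfl
  · exact end₃₃ hw hy hx₂ hs' hx' hy' hz' ex ey ez hH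
  · have h5x₂ : ¬ 5 ∣ x₂ := fun h₂ => by
      have h₃ : 5 ∣ x₃ := by omega
      exact hjp 5 (by norm_num) (by norm_num) (by omega) h₂ h₃ (by omega) (by omega) (by omega)
    have h5x₃ : ¬ 5 ∣ x₃ := fun h₃ => by
      have h₂ : 5 ∣ x₂ := by omega
      exact hjp 5 (by norm_num) (by norm_num) (by omega) h₂ h₃ (by omega) (by omega) (by omega)
    exact end₁₆₅ hw hs h5x₂ h5x₃ hs' hx' hy' hz' hyw ex ey ez hH

/-- **The row (U, Z1) for every `p ≥ 11`** at squarefree odd jointly-primitive levels: combines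
`row_UZ1_eleven` (p = 11) with `TheoremL13.row_UZ1_ge_thirteen` (p ≥ 13, any `n`). -/
theorem row_UZ1_eleven_up (p n y x₂ x₃ x' y' z' : ℕ) (hp : p.Prime) (h11 : 11 ≤ p) (hpn : ¬ p ∣ n)
    (hsq : Squarefree n) (hodd : Odd n)
    (hs : p * n ∣ p * y + x₂ + x₃) (hx₂ : ¬ p ∣ x₂) (hx₃ : ¬ p ∣ x₃)
    (hs' : p * n ∣ x' + y' + z') (hx' : ¬ p ∣ x') (hy' : ¬ p ∣ y') (hz' : ¬ p ∣ z') (hy : ¬ n ∣ y)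
    (hjp : ∀ q, Nat.Prime q → q ∣ p * n → q ∣ p * y → q ∣ x₂ → q ∣ x₃ → q ∣ x' → q ∣ y' → q ∣ z' → False)
    (hH : SameType (p * n) (p * y, x₂, x₃) (x', y', z')) : False := by
  rcases Nat.lt_or_ge p 13 with hlt | h13
  · obtain rfl : p = 11 := by
      interval_cases p
      · rfl
      · exact absurd hp (by norm_num)
    exact row_UZ1_eleven n y x₂ x₃ x' y' z' hsq hpn hodd hs hx₂ hx₃ hs' hx' hy' hz' hy hjp hH
  · exact row_UZ1_ge_thirteen p n y x₂ x₃ x' y' z' hp h13 hpn hodd.pos hodd hs hx₂ hx₃ hs' hx' hy' hz' hy hH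

end HodgeFermat.KRFree.RowUZ1Eleven
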